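import Summits.BirchSwinnertonDyer.BirchSwinnertonDyer.Theorems.SylvesterTwoHeegnerIndexUpperOffV0EisensteinTorsion
import HarnessLib

/-!
# `ℤ[ω]/2^M`-modules of rank one with a semilinear involution: the `τ`-eigenspaces at `p = 2`

Helper file of route `SylvesterTwoHeegnerIndex` (K7t), crux `UpperOffV0HSY` (item 19581), namespace
`Summit.BirchSwinnertonDyer.BirchSwinnertonDyer.Theorems.SylvesterTwoUpper.EisensteinTorsion`.  THEOREMS ONLY
(elementary module algebra continuing `…UpperOffV0EisensteinTorsion`; no elliptic curve in this file).

Setting of that file: `θ : N →+ N` with `θ² + θ + 1 = 0`, `N` finite of order `4^M`, `P` of order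
`2^M` (so `N = ℤ/2^M·P ⊕ ℤ/2^M·θP`).  Add an additive map `τ` which is `θ`-SEMILINEAR
(`τ ∘ θ = θ² ∘ τ`, i.e. `τ(ωx) = ω̄ τ(x)`) and fixes `P`.  This is complex conjugation on `E[2^M]`
for a CM curve `y² = x³ − c` over `ℚ` (`τ(ω) = ω² `), `P` a real `2^M`-torsion point.  At an odd
prime `p` a module with an involution splits as `T = T⁺ ⊕ T⁻` (the tree's
`KolyvaginEigen.exists_eigen_add_eigen`, `card_eq_card_mul_card`, used throughout McCallum §3);
at `p = 2` it does NOT, and this file computes the defect exactly: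

* `semilin_apply_lin` — `τ(a•P + b•θP) = (a − b)•P − b•θP`;
* `tau_eq_self_iff` — `N^{τ = 1} = ℤ/2^M · P` (cyclic of order `2^M`);
* `tau_eq_neg_iff` — `N^{τ = −1} = ℤ/2^M · (P + 2θP)` (cyclic of order `2^M`; `P + 2θP = √−3 · P`);
* `two_smul_mem_eigen_sum` — `2N ⊆ N⁺ + N⁻`;
* `theta_not_mem_eigen_sum` — `θP ∉ N⁺ + N⁻` (`M ≥ 1`): **`[N : N⁺ + N⁻] = 2` exactly** — the
  "`τ`-eigenspace defect" of the 2-adic Kolyvagin line (design step (a) of k7t-c2 g2's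
  KOLY2-PAIR-DESIGN), replacing the decomposition `E[p^M] = E[p^M]⁺ ⊕ E[p^M]⁻` of the odd case.
-/

set_option autoImplicit false
set_option linter.dupNamespace false

namespace Summit.BirchSwinnertonDyer.BirchSwinnertonDyer.Theorems.SylvesterTwoUpper.EisensteinTorsion

variable {N : Type*} [AddCommGroup N] (θ : N →+ N) (hθ : ∀ x, θ (θ x) + θ x + x = 0)
  (τ : N →+ N) (hτθ : ∀ x, τ (θ x) = θ (θ (τ x))) {P : N} (hτP : τ P = P)

include hθ hτθ hτP

/-- **A `θ`-semilinear `τ` fixing `P` in coordinates**: `τ(a•P + b•θP) = (a − b)•P − b•θP`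
(`τ(θP) = θ²P = −θP − P`). [folklore] -/
theorem semilin_apply_lin (a b : ℤ) : τ (a • P + b • θ P) = (a - b) • P - b • θ P := by
  have h2 := apply_apply_eq θ hθ P
  simp only [map_add, map_zsmul, hτθ, hτP, h2]
  module

variable [Finite N] {M : ℕ} (hcard : Nat.card N = 4 ^ M) (hP : addOrderOf P = 2 ^ M)
include hcard hP

omit hτθ hτP in
/-- `2^M` kills `N = ℤ[ω]·P`: `(2^M k)•x = 0`. [folklore] -/
theorem pow_mul_zsmul_eq_zero (k : ℤ) (x : N) : ((2 : ℤ) ^ M * k) • x = 0 := by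
  obtain ⟨a, b, rfl⟩ := exists_lin_eq θ hθ hcard hP x
  have hMP : ((2 : ℤ) ^ M) • P = 0 := by
    have := addOrderOf_nsmul_eq_zero P
    rw [hP] at this
    exact_mod_cast this
  have e : ((2 : ℤ) ^ M * k) • (a • P + b • θ P) =
      (k * a) • (((2 : ℤ) ^ M) • P) + (k * b) • θ (((2 : ℤ) ^ M) • P) := by
    rw [map_zsmul]; module
  rw [e, hMP, map_zero, smul_zero, smul_zero, add_zero]

/-- **`N^{τ=1} = ℤ/2^M · P`**: the `τ`-fixed vectors are exactly the multiples of `P`. [folklore] -/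
theorem tau_eq_self_iff (x : N) : τ x = x ↔ ∃ a : ℤ, x = a • P := by
  constructor
  · intro hx
    obtain ⟨a, b, rfl⟩ := exists_lin_eq θ hθ hcard hP x
    rw [semilin_apply_lin θ hθ τ hτθ hτP] at hx
    have h0 : (-b) • P + (-(2 * b)) • θ P = 0 := by
      rw [← sub_eq_zero.mpr hx]; module
    obtain ⟨hb, -⟩ := dvd_and_dvd_of_lin_eq_zero θ hθ M P hP _ _ h0
    rw [dvd_neg] at hb
    obtain ⟨k, hk⟩ := hb
    refine ⟨a, ?_⟩
    rw [hk, pow_mul_zsmul_eq_zero θ hθ hcard hP k (θ P), add_zero]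
  · rintro ⟨a, rfl⟩
    rw [map_zsmul, hτP]

/-- **`N^{τ=−1} = ℤ/2^M · (P + 2θP)`** (`P + 2θP = (1 + 2ω)P = √−3·P`): the anti-fixed vectors are
exactly the multiples of `P + 2θP`. [folklore] -/
theorem tau_eq_neg_iff (x : N) : τ x = -x ↔ ∃ a : ℤ, x = a • (P + (2 : ℤ) • θ P) := by
  constructor
  · intro hx
    obtain ⟨a, b, rfl⟩ := exists_lin_eq θ hθ hcard hP x
    rw [semilin_apply_lin θ hθ τ hτθ hτP] at hx
    have h0 : (2 * a - b) • P + (0 : ℤ) • θ P = 0 := by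
      rw [← sub_eq_zero.mpr hx]; module
    obtain ⟨⟨k, hk⟩, -⟩ := dvd_and_dvd_of_lin_eq_zero θ hθ M P hP _ _ h0
    refine ⟨a, ?_⟩
    have hb : b = 2 * a - 2 ^ M * k := by linarith
    have hz := pow_mul_zsmul_eq_zero θ hθ hcard hP (-k) (θ P)
    rw [← sub_eq_zero]
    have e : a • P + b • θ P - a • (P + (2 : ℤ) • θ P) = ((2 : ℤ) ^ M * (-k)) • θ P := by
      rw [hb]; module
    rw [e, hz]
  · rintro ⟨a, rfl⟩
    have h2 := apply_apply_eq θ hθ P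
    simp only [map_add, map_zsmul, hτθ, hτP, h2, smul_add, smul_sub, smul_neg, neg_add]
    module

omit hτθ hτP in
/-- **`2N ⊆ N⁺ + N⁻`**: `2x` is a sum of a `τ`-fixed and a `τ`-anti-fixed vector
(`2(aP + bθP) = (2a − b)P + b(P + 2θP)`). [folklore] -/
theorem two_smul_mem_eigen_sum (x : N) :
    ∃ a c : ℤ, (2 : ℤ) • x = a • P + c • (P + (2 : ℤ) • θ P) := by
  obtain ⟨a, b, rfl⟩ := exists_lin_eq θ hθ hcard hP x
  exact ⟨2 * a - b, b, by module⟩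

omit [Finite N] hτθ hτP hcard in
/-- **The defect is exactly `2`**: `θP ∉ N⁺ + N⁻` when `M ≥ 1` (the `θP`-coordinate of
`aP + c(P + 2θP)` is even). Together with `two_smul_mem_eigen_sum`: `N/(N⁺ + N⁻) ≅ ℤ/2`, whereas
at an odd prime the eigenspaces span everything. [folklore] -/
theorem theta_not_mem_eigen_sum (hM : 1 ≤ M) (a c : ℤ) : θ P ≠ a • P + c • (P + (2 : ℤ) • θ P) := by
  intro h
  have h0 : (a + c) • P + (2 * c - 1) • θ P = 0 := by
    rw [← sub_eq_zero.mpr h.symm]; module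
  obtain ⟨-, hc⟩ := dvd_and_dvd_of_lin_eq_zero θ hθ M P hP _ _ h0
  have h2 : (2 : ℤ) ∣ 2 * c - 1 := (dvd_pow_self 2 (by omega)).trans hc
  omega

/-! ### Appendix (k7t-c2 g3, same session): a `τ`-fixed generator always exists -/

omit hτθ hτP in
/-- **Order criterion**: `a•P + b•θP` has order `2^M` as soon as `a, b` are not both even
(`M ≥ 1`). [folklore] -/
theorem addOrderOf_lin_eq_two_pow (hM : 1 ≤ M) {a b : ℤ} (hab : ¬ ((2 : ℤ) ∣ a ∧ (2 : ℤ) ∣ b)) :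
    addOrderOf (a • P + b • θ P) = 2 ^ M := by
  obtain ⟨k, hk⟩ : ∃ k, M = k + 1 := ⟨M - 1, by omega⟩
  subst hk
  refine addOrderOf_eq_prime_pow (p := 2) (n := k) (fun h0 => hab ?_) ?_
  · have h0' : ((2 : ℤ) ^ k * a) • P + ((2 : ℤ) ^ k * b) • θ P = 0 := by
      rw [← h0]; module
    obtain ⟨ha, hb⟩ := dvd_and_dvd_of_lin_eq_zero θ hθ (k + 1) P hP _ _ h0'
    rw [pow_succ] at ha hb
    exact ⟨Int.dvd_of_mul_dvd_mul_left (pow_ne_zero k two_ne_zero) ha,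
      Int.dvd_of_mul_dvd_mul_left (pow_ne_zero k two_ne_zero) hb⟩
  · have h := pow_mul_zsmul_eq_zero θ hθ hcard hP 1 (a • P + b • θ P)
    rw [mul_one] at h
    exact_mod_cast h

omit hτP in
/-- **A `θ`-semilinear additive INVOLUTION has a fixed vector of order `2^M`** (`M ≥ 1`): one of
`P + τP`, `θP + τ(θP)` (both `τ`-fixed as `τ² = 1`) has order `2^M` — if `τP = αP + βθP` then
`P + τP = (1+α)P + βθP` and `θP + τ(θP) = (β−α)P + (1−α)θP`, and the two coordinate pairs are
not both even simultaneously.  Hence all the eigenspace statements of this file apply to complex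
conjugation on `E[2^M]` for a CM curve `y² = x³ − c` WITHOUT any real-point input. [folklore] -/
theorem exists_tau_fixed_addOrderOf_eq (hτ2 : ∀ x, τ (τ x) = x) (hM : 1 ≤ M) :
    ∃ Q : N, τ Q = Q ∧ addOrderOf Q = 2 ^ M := by
  obtain ⟨α, β, hαβ⟩ := exists_lin_eq θ hθ hcard hP (τ P)
  have h2 := apply_apply_eq θ hθ P
  by_cases hpar : (2 : ℤ) ∣ (1 + α) ∧ (2 : ℤ) ∣ β
  · -- use `θP + τ(θP) = (β − α)P + (1 − α)θP`, first coordinate odd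
    refine ⟨θ P + τ (θ P), by rw [map_add, hτ2, add_comm], ?_⟩
    have e : θ P + τ (θ P) = (β - α) • P + (1 - α) • θ P := by
      rw [hτθ, hαβ]
      simp only [map_add, map_zsmul, h2, smul_sub, smul_neg, map_neg, map_sub]
      module
    rw [e]
    refine addOrderOf_lin_eq_two_pow θ hθ hcard hP hM fun ⟨h1, _⟩ => ?_
    obtain ⟨hα, _⟩ := hpar
    have : (2 : ℤ) ∣ (1 + α) - (β - α) - β + 2 * β := by omega
    omega
  · refine ⟨P + τ P, by rw [map_add, hτ2, add_comm], ?_⟩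
    have e : P + τ P = (1 + α) • P + β • θ P := by rw [hαβ]; module
    rw [e]
    exact addOrderOf_lin_eq_two_pow θ hθ hcard hP hM hpar

/-! ### Appendix 2 (k7t-c2 g3): the trace maps `1 ± τ` are ONTO the eigenspaces at `2` -/

omit [Finite N] hcard hP in
/-- **`(1 + τ)N = N⁺` at `2`**: every multiple of the fixed generator `P` is a trace `x + τx`
(`(1+τ)(−a•θP) = a•P`, as `θP + τ(θP) = −P`).  This replaces McCallum's `u = 1/2`
(`(2u)•P = P`, impossible at `2`) when solving `[c, ρ^τρ] = (1 + τ)φ_c(ρ)` for a prescribed value.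
[folklore] -/
theorem exists_add_tau_eq (a : ℤ) : ∃ x : N, x + τ x = a • P := by
  have h2 := apply_apply_eq θ hθ P
  refine ⟨(-a) • θ P, ?_⟩
  rw [map_zsmul, hτθ, hτP, h2]
  simp only [smul_sub, smul_neg]
  module

omit [Finite N] hcard hP in
/-- **`(1 − τ)N = N⁻` at `2`**: every multiple of the anti-fixed generator `P + 2θP` is an
anti-trace `x − τx` (`(1−τ)(a•θP) = a•(P + 2θP)`). [folklore] -/
theorem exists_sub_tau_eq (a : ℤ) : ∃ x : N, x - τ x = a • (P + (2 : ℤ) • θ P) := by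
  have h2 := apply_apply_eq θ hθ P
  refine ⟨a • θ P, ?_⟩
  rw [map_zsmul, hτθ, hτP, h2]
  simp only [smul_add, smul_sub, smul_neg]
  module

end Summit.BirchSwinnertonDyer.BirchSwinnertonDyer.Theorems.SylvesterTwoUpper.EisensteinTorsion

/-! ### Appendix 3 (k7t-c2 g3): the defect of an involution on ANY `2`-group (Selmer level)

For the count of a 2-adic Kolyvagin descent (McCallum §5 splits `s = s⁺ + s⁻` using `2⁻¹`): on any
additive group with an involution `τ`, `2v = (v + τv) + (v − τv)` lies in `V⁺ + V⁻`, so bounds on the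
two eigenspaces bound `V` up to ONE extra factor `2` — the defect `δ ≤ 1` per splitting. -/

namespace Summit.BirchSwinnertonDyer.BirchSwinnertonDyer.Theorems.SylvesterTwoUpper.InvolutionDefect

variable {V : Type*} [AddCommGroup V] (τ : V →+ V) (hτ : ∀ v, τ (τ v) = v)
include hτ

/-- `v + τv` is `τ`-fixed and `v − τv` is `τ`-anti-fixed (`τ² = 1`). [folklore] -/
theorem add_tau_fixed_and_sub_tau_antifixed (v : V) :
    τ (v + τ v) = v + τ v ∧ τ (v - τ v) = -(v - τ v) := by
  constructor
  · rw [map_add, hτ, add_comm]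
  · rw [map_sub, hτ, neg_sub]

/-- **`2V ⊆ V⁺ + V⁻`** for an involution on any additive group: `2v = (v + τv) + (v − τv)`.
[folklore] -/
theorem two_smul_eq_fixed_add_antifixed (v : V) :
    ∃ a b : V, τ a = a ∧ τ b = -b ∧ (2 : ℤ) • v = a + b :=
  ⟨v + τ v, v - τ v, (add_tau_fixed_and_sub_tau_antifixed τ hτ v).1,
    (add_tau_fixed_and_sub_tau_antifixed τ hτ v).2, by rw [two_zsmul]; abel⟩

/-- **Eigenspace bounds bound everything with defect one**: if `2^a` kills `V^{τ=1}` and `2^b`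
kills `V^{τ=−1}`, then `2^{max(a,b)+1}` kills `V`.  (At an odd prime the `+1` disappears.)
[folklore] -/
theorem pow_succ_smul_eq_zero_of_eigen_bounds {a b : ℕ}
    (hplus : ∀ w : V, τ w = w → ((2 : ℤ) ^ a) • w = 0)
    (hminus : ∀ w : V, τ w = -w → ((2 : ℤ) ^ b) • w = 0) (v : V) :
    ((2 : ℤ) ^ (max a b + 1)) • v = 0 := by
  obtain ⟨x, y, hx, hy, h2⟩ := two_smul_eq_fixed_add_antifixed τ hτ v
  have hxk : ((2 : ℤ) ^ max a b) • x = 0 := by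
    rw [← Nat.sub_add_cancel (le_max_left a b), pow_add, mul_zsmul, hplus x hx, smul_zero]
  have hyk : ((2 : ℤ) ^ max a b) • y = 0 := by
    rw [← Nat.sub_add_cancel (le_max_right a b), pow_add, mul_zsmul, hminus y hy, smul_zero]
  rw [pow_succ, mul_zsmul, h2, smul_add, hxk, hyk, add_zero]

end Summit.BirchSwinnertonDyer.BirchSwinnertonDyer.Theorems.SylvesterTwoUpper.InvolutionDefect
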